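import Mathlib
import HarnessLib
import Summits.NavierStokesRegularity.NavierStokesRegularity.Theorems.TaylorModelRungThreeCertificateFormat
import Summits.NavierStokesRegularity.NavierStokesRegularity.Theorems.TaylorModelRungThreeCertificateSoundBridge
import Summits.NavierStokesRegularity.NavierStokesRegularity.Theorems.TaylorModelRungThreeReadoutCoords

/-!
# Crux K1b-DR (stmt-NavierStokesRegularity-23954), line `taylor-model` — certificate SOUNDNESS, part 2: the FIELD
# bridge (the truncated cascade field of `toCertData φ T` versus the checker's `qTK` / `QbVec` / `symQbMat`)

Under the hypothesis `CoefOK φ T` — the effective-coefficient table of the certificate is the structure table times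
the clock factor, `φ (coef) = φ (α) · 2^(5(k-μ₃)/2)` (exact in `ℚ(√2)`; CERT-CONTRACT-23954 v1 §1–§2; it is the
one proof obligation the format file leaves to soundness) — the window-truncated field `qT` and its polarisation
`Qb` of the interpreted record `T.toCertData φ` agree, on table vectors, with the image under `φ` of the checker's
exact computations `qTK`, `QbVec`; the interpretation `linR` of list-coded matrices is linear, compatible with
`smulMatN` / `addMatN` / sums / `mulMatN` (composition), and `linR (symQbMat a) y = Qb a y + Qb y a`. These are the
identities behind the soundness of the jet clauses a18/a20 of `Chain` and of the bilinear-bound / defect / section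
clauses elsewhere. Bookkeeping only; MODEL-lattice rung TL-M3; nothing here concerns the Navier–Stokes equations.
-/

-- the sub-problem namespace repeats the summit name by design (D-0017)
set_option linter.dupNamespace false

namespace Summit.NavierStokesRegularity.NavierStokesRegularity.Theorems.TaylorModelCert

open scoped BigOperators
open Literature.Analysis.FluidPDE.TaoCascade Literature.Analysis.FluidPDE.TaoCascade.TaylorChain
open Summit.NavierStokesRegularity.NavierStokesRegularity.Theorems.TaylorModelReadout (trunc qB trunc_apply qT_eq_qB
  Qb_eq Qb_add_left Qb_add_right Qb_smul_left Qb_smul_right Qb_trunc wsupp_Qb trunc_eq_self)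

namespace CertTables

section Field

/-- **The coefficient hypothesis** (a PREDICATE on the tables and the cast `φ`, assumed by the soundness
theorems — not a fact) of CERT-CONTRACT-23954 §2: the effective-coefficient table is the structure table times
the clock factor `2^(5(k-μ₃)/2)` of Tao's field at `ε₀ = 1`, on the window. [folklore] -/
def CoefOK {K : Type} [Field K] (φ : K →+* ℝ) (T : CertTables K) : Prop :=
  ∀ (a b i : Fin 4) (μi : ℕ) (k : ℤ), μi < 4 → -T.Kb ≤ k → k ≤ T.Ka →
    φ (T.coefAt a b i μi k) = φ (vget T.α (((a.val * 4 + b.val) * 4 + i.val) * 4 + μi)) *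
      (2 : ℝ) ^ ((5 : ℝ) * (k - (shifts.getD μi (0, 0, 0)).2.2) / 2)

variable {K : Type} [Field K] (φ : K →+* ℝ) (T : CertTables K)

/-! ### Projections of `toCertData` used below -/

/-- `Kb` of the interpreted record. [folklore] -/
@[simp] theorem toCertData_Kb : (T.toCertData φ).Kb = T.Kb := rfl
/-- `Ka` of the interpreted record. [folklore] -/
@[simp] theorem toCertData_Ka : (T.toCertData φ).Ka = T.Ka := rfl
/-- `pdeg` of the interpreted record. [folklore] -/
@[simp] theorem toCertData_pdeg : (T.toCertData φ).pdeg = T.pdeg := rfl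
/-- The structure table of the interpreted record. [folklore] -/
theorem toCertData_α (a b i : Fin 4) (μ : ℤ × ℤ × ℤ) : (T.toCertData φ).α a b i μ =
    if shiftIdx μ < 4 then φ (vget T.α (((a.val * 4 + b.val) * 4 + i.val) * 4 + shiftIdx μ)) else 0 := rfl

/-- The four shifts of the table order, by index. [folklore] -/
theorem shifts_getD (μi : ℕ) (hμ : μi < 4) :
    shiftIdx (shifts.getD μi (0, 0, 0)) = μi := by
  interval_cases μi <;> rfl

/-! ### Truncation and table vectors -/

/-- Table vectors are window-supported, hence their own truncation. [folklore] -/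
theorem trunc_vecR (v : List K) : trunc (T.toCertData φ) (T.vecR φ v) = T.vecR φ v := by
  funext i k
  by_cases hk : -T.Kb ≤ k ∧ k ≤ T.Ka
  · simp [trunc_apply, hk]
  · simp [trunc_apply, hk, T.vecR_off φ v i hk]

/-- The checker's `comp` is the table vector under `φ`. [folklore] -/
theorem map_comp (y : List K) (a : Fin 4) (k' : ℤ) : φ (T.comp y a k') = T.vecR φ y a k' := by
  unfold comp
  rw [T.vecR_apply]
  split_ifs <;> simp

/-- Sum of table vectors is the table vector of `addVecN`. [folklore] -/
theorem vecR_add (u v : List K) : T.vecR φ u + T.vecR φ v = T.vecR φ (addVecN T.n u v) := by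
  funext i k
  simp only [Pi.add_apply, T.vecR_apply]
  by_cases hk : -T.Kb ≤ k ∧ k ≤ T.Ka
  · rw [if_pos hk, if_pos hk, if_pos hk, vget_addVecN _ _ (T.idx_lt_n i hk), map_add]
  · rw [if_neg hk, if_neg hk, if_neg hk, add_zero]

/-- The truncation of a state is the combination of the coordinate table vectors with its window values. [folklore] -/
theorem trunc_eq_sum_basis (y : Fin 4 → ℤ → ℝ) :
    trunc (T.toCertData φ) y = ∑ c ∈ Finset.range T.n, T.wv y c • T.vecR φ (T.basisVec c) := by
  funext i k
  rw [Finset.sum_apply, Finset.sum_apply]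
  simp only [Pi.smul_apply, smul_eq_mul, T.vecR_apply, trunc_apply, toCertData_Kb, toCertData_Ka]
  by_cases hk : -T.Kb ≤ k ∧ k ≤ T.Ka
  · simp only [hk, and_self, ↓reduceIte]
    have hlt := T.idx_lt_n i hk
    have : ∀ c ∈ Finset.range T.n, T.wv y c * φ (vget (T.basisVec c) (T.idx i k)) =
        if T.idx i k = c then T.wv y c else 0 := by
      intro c _
      rw [T.vget_basisVec hlt]
      split_ifs <;> simp
    rw [Finset.sum_congr rfl this, Finset.sum_ite_eq, if_pos (Finset.mem_range.2 hlt), T.wv_idx y i hk]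
  · simp [hk]

/-! ### The field on table vectors -/

/-- The shift-set sum as a sum over the table order. [folklore] -/
theorem sum_shiftSet_eq (g : ℤ × ℤ × ℤ → ℝ) :
    ∑ μ ∈ shiftSet, g μ = ∑ μi ∈ Finset.range 4, g (shifts.getD μi (0, 0, 0)) := by
  simp [shiftSet, shifts, Finset.sum_range_succ]
  ring

/-- A `Fin 4` sum as a `range 4` sum through the checker's index cast. [folklore] -/
theorem sum_fin4_eq (g : Fin 4 → ℝ) :
    ∑ a : Fin 4, g a = ∑ a ∈ Finset.range 4, g ⟨a % 4, Nat.mod_lt _ (by omega)⟩ := by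
  rw [Finset.sum_range]
  refine Finset.sum_congr rfl fun a _ => ?_
  congr 1
  exact Fin.ext (Nat.mod_eq_of_lt a.isLt).symm

variable {φ T} in
/-- **The truncated field on a table vector is the checker's `qTK` under `φ`** (window coordinates). [folklore] -/
theorem qT_vecR (hco : T.CoefOK φ) (y : List K) (i : Fin 4) {k : ℤ} (hk : -T.Kb ≤ k ∧ k ≤ T.Ka) :
    (T.toCertData φ).qT (T.vecR φ y) i k = φ (T.qTK y i k) := by
  rw [qT_eq_qB]
  unfold qB qTK
  simp only [toCertData_Kb, toCertData_Ka, hk, and_self, ↓reduceIte, trunc_vecR, sumN_eq, map_sum, map_mul,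
    map_comp]
  rw [sum_fin4_eq]
  refine Finset.sum_congr rfl fun a ha => ?_
  rw [sum_fin4_eq]
  refine Finset.sum_congr rfl fun b hb => ?_
  rw [sum_shiftSet_eq]
  refine Finset.sum_congr rfl fun μi hμi => ?_
  rw [Finset.mem_range] at hμi
  rw [hco _ _ i μi k hμi hk.1 hk.2, toCertData_α, shifts_getD μi hμi, if_pos hμi]
  norm_num

variable {φ T} in
/-- Window values of `qTvec`. [folklore] -/
theorem vget_qTvec (y : List K) {c : ℕ} (hc : c < T.n) : vget (T.qTvec y) c = T.qTK y (T.wi c) (T.wk c) := by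
  unfold qTvec
  rw [vget_map_range _ hc]
  rfl

variable {φ T} in
/-- **The polarised field on table vectors is the checker's `QbVec`** (as shell states). [folklore] -/
theorem Qb_vecR (hco : T.CoefOK φ) (u v : List K) :
    (T.toCertData φ).Qb (T.vecR φ u) (T.vecR φ v) = T.vecR φ (T.QbVec u v) := by
  funext i k
  by_cases hk : -T.Kb ≤ k ∧ k ≤ T.Ka
  · have hlt := T.idx_lt_n i hk
    unfold CertData.Qb
    rw [vecR_add, qT_vecR hco _ i hk, qT_vecR hco _ i hk, qT_vecR hco _ i hk, T.vecR_apply, if_pos hk]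
    unfold QbVec
    rw [vget_map_range _ hlt, vget_qTvec _ hlt, vget_qTvec _ hlt, vget_qTvec _ hlt, T.wi_idx i hk, T.wk_idx i hk]
    simp [map_sub, map_div₀, map_ofNat]
  · rw [wsupp_Qb _ _ _ i k hk, T.vecR_off φ _ i hk]

/-! ### The interpretation of list-coded matrices is linear and multiplicative -/

/-- `linR` is additive. [folklore] -/
theorem linR_add (A : List (List K)) (y y' : Fin 4 → ℤ → ℝ) :
    T.linR φ A (y + y') = T.linR φ A y + T.linR φ A y' := by
  funext i k
  simp only [Pi.add_apply]
  by_cases hk : -T.Kb ≤ k ∧ k ≤ T.Ka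
  · simp only [T.linR_apply_of_InW φ A _ i hk, ← Finset.sum_add_distrib]
    refine Finset.sum_congr rfl fun c _ => ?_
    simp only [wv, Pi.add_apply]; ring
  · simp [T.linR_off φ A _ i hk]

/-- `linR` is homogeneous. [folklore] -/
theorem linR_smul (A : List (List K)) (r : ℝ) (y : Fin 4 → ℤ → ℝ) :
    T.linR φ A (r • y) = r • T.linR φ A y := by
  funext i k
  simp only [Pi.smul_apply, smul_eq_mul]
  by_cases hk : -T.Kb ≤ k ∧ k ≤ T.Ka
  · simp only [T.linR_apply_of_InW φ A _ i hk, Finset.mul_sum]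
    refine Finset.sum_congr rfl fun c _ => ?_
    simp only [wv, Pi.smul_apply, smul_eq_mul]; ring
  · simp [T.linR_off φ A _ i hk]

/-- `linR A` is an `ℝ`-linear map. [folklore] -/
theorem isLinearMap_linR (A : List (List K)) : IsLinearMap ℝ (T.linR φ A) :=
  ⟨T.linR_add φ A, T.linR_smul φ A⟩

/-- `linR` is window-supported. [folklore] -/
theorem wsupp_linR (A : List (List K)) (y : Fin 4 → ℤ → ℝ) : (T.toCertData φ).Wsupp (T.linR φ A y) :=
  fun i _ hk => T.linR_off φ A y i hk

/-- `linR` only depends on the listed `n × n` entries. [folklore] -/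
theorem linR_congr {A B : List (List K)} (h : ∀ r < T.n, ∀ c < T.n, mget A r c = mget B r c)
    (y : Fin 4 → ℤ → ℝ) : T.linR φ A y = T.linR φ B y := by
  refine T.eq_of_wv_eq (fun i k hk => T.linR_off φ A y i hk) (fun i k hk => T.linR_off φ B y i hk) fun r hr => ?_
  rw [T.wv_linR φ A y hr, T.wv_linR φ B y hr]
  exact Finset.sum_congr rfl fun c hc => by rw [h r hr c (Finset.mem_range.1 hc)]

/-- `linR` of a scalar multiple. [folklore] -/
theorem linR_smulMatN (a : K) (A : List (List K)) (y : Fin 4 → ℤ → ℝ) :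
    T.linR φ (smulMatN T.n a A) y = φ a • T.linR φ A y := by
  refine T.eq_of_wv_eq (fun i k hk => T.linR_off φ _ y i hk) (fun i k hk => ?_) fun r hr => ?_
  · simp [T.linR_off φ A y i hk]
  · rw [T.wv_linR φ _ y hr]
    show _ = φ a * T.wv (T.linR φ A y) r
    rw [T.wv_linR φ A y hr, Finset.mul_sum]
    refine Finset.sum_congr rfl fun c hc => ?_
    rw [mget_smulMatN _ _ hr (Finset.mem_range.1 hc), map_mul]; ring

/-- `linR` of a sum of matrices. [folklore] -/
theorem linR_addMatN (A B : List (List K)) (y : Fin 4 → ℤ → ℝ) :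
    T.linR φ (addMatN T.n A B) y = T.linR φ A y + T.linR φ B y := by
  refine T.eq_of_wv_eq (fun i k hk => T.linR_off φ _ y i hk) (fun i k hk => ?_) fun r hr => ?_
  · simp [T.linR_off φ A y i hk, T.linR_off φ B y i hk]
  · rw [T.wv_linR φ _ y hr]
    show _ = T.wv (T.linR φ A y) r + T.wv (T.linR φ B y) r
    rw [T.wv_linR φ A y hr, T.wv_linR φ B y hr, ← Finset.sum_add_distrib]
    refine Finset.sum_congr rfl fun c hc => ?_
    rw [mget_addMatN _ _ hr (Finset.mem_range.1 hc), map_add]; ring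

/-- `linR` of the zero matrix. [folklore] -/
theorem linR_zeroMat (y : Fin 4 → ℤ → ℝ) :
    T.linR φ ((List.range T.n).map fun _ => (List.range T.n).map fun _ => (0 : K)) y = 0 := by
  refine T.eq_of_wv_eq (fun i k hk => T.linR_off φ _ y i hk) (fun _ _ _ => rfl) fun r hr => ?_
  rw [T.wv_linR φ _ y hr]
  show _ = (0 : ℝ)
  exact Finset.sum_eq_zero fun c hc => by rw [mget_zeroMat hr (Finset.mem_range.1 hc), map_zero, zero_mul]

/-- `linR` of a `foldr`-sum of matrices. [folklore] -/
theorem linR_foldr_addMatN (N : ℕ) (g : ℕ → List (List K)) (y : Fin 4 → ℤ → ℝ) :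
    T.linR φ ((List.range N).foldr (fun m' acc => addMatN T.n (g m') acc)
      ((List.range T.n).map fun _ => (List.range T.n).map fun _ => (0 : K))) y =
      ∑ m' ∈ Finset.range N, T.linR φ (g m') y := by
  induction N with
  | zero => simpa using T.linR_zeroMat φ y
  | succ N ih =>
    rw [List.range_succ, List.foldr_append, List.foldr_cons, List.foldr_nil, Finset.sum_range_succ]
    -- move the last summand to the front of the fold
    have key : ∀ (l : List ℕ) (B : List (List K)),
        T.linR φ (l.foldr (fun m' acc => addMatN T.n (g m') acc) B) y =
          T.linR φ (l.foldr (fun m' acc => addMatN T.n (g m') acc)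
            ((List.range T.n).map fun _ => (List.range T.n).map fun _ => (0 : K))) y + T.linR φ B y := by
      intro l
      induction l with
      | nil => intro B; simp only [List.foldr_nil]; rw [T.linR_zeroMat φ y, zero_add]
      | cons a l ihl => intro B; simp only [List.foldr_cons, T.linR_addMatN φ]; rw [ihl B]; abel
    rw [key, ih, T.linR_addMatN φ, T.linR_zeroMat φ, add_zero]

/-- `linR` is multiplicative: the matrix product interprets as composition. [folklore] -/
theorem linR_mulMatN (A B : List (List K)) (y : Fin 4 → ℤ → ℝ) :
    T.linR φ (mulMatN T.n A B) y = T.linR φ A (T.linR φ B y) := by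
  refine T.eq_of_wv_eq (fun i k hk => T.linR_off φ _ y i hk) (fun i k hk => T.linR_off φ A _ i hk) fun r hr => ?_
  rw [T.wv_linR φ _ y hr, T.wv_linR φ A _ hr]
  have : ∀ t ∈ Finset.range T.n, φ (mget A r t) * T.wv (T.linR φ B y) t =
      ∑ c ∈ Finset.range T.n, φ (mget A r t) * φ (mget B t c) * T.wv y c := by
    intro t ht
    rw [T.wv_linR φ B y (Finset.mem_range.1 ht), Finset.mul_sum]
    exact Finset.sum_congr rfl fun c _ => by ring
  rw [Finset.sum_congr rfl this, Finset.sum_comm]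
  refine Finset.sum_congr rfl fun c hc => ?_
  rw [mget_mulMatN _ _ hr (Finset.mem_range.1 hc), map_sum, Finset.sum_mul]
  exact Finset.sum_congr rfl fun t _ => by rw [map_mul]

/-- `linR A` applied to a coordinate table vector is the table vector of the column. [folklore] -/
theorem linR_vecR (A : List (List K)) (v : List K) :
    T.linR φ A (T.vecR φ v) = T.vecR φ (mulVecN T.n A v) := by
  refine T.eq_of_wv_eq (fun i k hk => T.linR_off φ _ _ i hk) (fun i k hk => T.vecR_off φ _ i hk) fun r hr => ?_
  rw [T.wv_linR φ _ _ hr, T.wv_vecR φ _ hr, vget_mulVecN _ _ hr, map_sum]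
  refine Finset.sum_congr rfl fun c hc => ?_
  rw [T.wv_vecR φ _ (Finset.mem_range.1 hc), map_mul]

variable {φ T} in
/-- **`linR (symQbMat a) y = Qb a y + Qb y a`** (the matrix of `v ↦ Qb(a,v) + Qb(v,a)` in window coordinates). [folklore] -/
theorem linR_symQbMat (hco : T.CoefOK φ) (a : List K) (y : Fin 4 → ℤ → ℝ) :
    T.linR φ (T.symQbMat a) y =
      (T.toCertData φ).Qb (T.vecR φ a) y + (T.toCertData φ).Qb y (T.vecR φ a) := by
  -- both sides only see the window values of `y`: reduce to the truncation, a combination of basis vectors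
  have hy : (T.toCertData φ).Qb (T.vecR φ a) y + (T.toCertData φ).Qb y (T.vecR φ a) =
      (T.toCertData φ).Qb (T.vecR φ a) (trunc (T.toCertData φ) y) +
        (T.toCertData φ).Qb (trunc (T.toCertData φ) y) (T.vecR φ a) := by
    rw [← Qb_trunc (T.toCertData φ) (T.vecR φ a) y, ← Qb_trunc (T.toCertData φ) y (T.vecR φ a), trunc_vecR]
  rw [hy, trunc_eq_sum_basis]
  refine T.eq_of_wv_eq (fun i k hk => T.linR_off φ _ _ i hk) (fun i k hk => ?_) fun r hr => ?_
  · simp only [Pi.add_apply]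
    rw [wsupp_Qb (T.toCertData φ) _ _ i k hk, wsupp_Qb (T.toCertData φ) _ _ i k hk, add_zero]
  · rw [T.wv_linR φ _ _ hr]
    -- push the basis sum through the bilinear `Qb`
    have hL : ∀ (s : Finset ℕ) (w : ℕ → ℝ) (e : ℕ → (Fin 4 → ℤ → ℝ)) (u : Fin 4 → ℤ → ℝ),
        (T.toCertData φ).Qb u (∑ c ∈ s, w c • e c) + (T.toCertData φ).Qb (∑ c ∈ s, w c • e c) u =
          ∑ c ∈ s, w c • ((T.toCertData φ).Qb u (e c) + (T.toCertData φ).Qb (e c) u) := by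
      intro s w e u
      induction s using Finset.induction_on with
      | empty =>
        simp only [Finset.sum_empty]
        have h0 : (T.toCertData φ).Qb u 0 = 0 := by simpa using Qb_smul_right (T.toCertData φ) 0 u 0
        have h0' : (T.toCertData φ).Qb 0 u = 0 := by simpa using Qb_smul_left (T.toCertData φ) 0 0 u
        rw [h0, h0', add_zero]
      | insert c s hc ih =>
        rw [Finset.sum_insert hc, Finset.sum_insert hc, Qb_add_right, Qb_add_left, Qb_smul_right, Qb_smul_left,
          ← ih, smul_add]
        abel
    rw [hL]
    unfold wv
    rw [Finset.sum_apply, Finset.sum_apply]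
    refine Finset.sum_congr rfl fun c hc => ?_
    have hc' := Finset.mem_range.1 hc
    simp only [Pi.smul_apply, Pi.add_apply, smul_eq_mul]
    rw [Qb_vecR hco, Qb_vecR hco, mul_comm]
    congr 1
    unfold symQbMat
    rw [mget_map_range _ hr hc', map_add]
    show _ = T.wv (T.vecR φ (T.QbVec a (T.basisVec c))) r + T.wv (T.vecR φ (T.QbVec (T.basisVec c) a)) r
    rw [T.wv_vecR φ _ hr, T.wv_vecR φ _ hr]

end Field

end CertTables

end Summit.NavierStokesRegularity.NavierStokesRegularity.Theorems.TaylorModelCert
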